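import Summits.Ventures.YMGap.Thresholds.ZeroCouplingOnePlaquetteLaw
import HarnessLib

/-!
# The free energy density of EVERY lattice gauge theory is `#planes` copies of the one-plaquette (two-dimensional) free energy
# through fourth order in `β` (row type C-SLOPE-0-G, part 4c)

Cell `pub-ymgap`, seat ds-1 (gen 15). HONEST FRAMING: exact LATTICE statement at the strong-coupling end point `β = 0` of the Wilson
action on `ℤ^d` for an ARBITRARY compact metrisable gauge group `G` (universe `0`), continuous `ρ`, every `d`, both signs of `β`, on the
torus-expansion corner `|β| < betaOne d ρ / 4` where the tree's every-`G` DLR selection lives. Generality/exactness, not a threshold;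
nothing about weak coupling, the continuum, or Clay. Kernel theorems, 0 defs, 0 compute.

* `freeEnergyDensity_zero_eq`: `f(0) = 0` (the torus partition function at `β = 0` is `1`).
* `hasDerivAt_cgf_onePlaquette`: the one-plaquette free energy `F₁(β) = log ∫ e^{β(Re tr ρ − N)} dHaar` (Mathlib's `cgf` of `Re tr ρ − N`
  under Haar measure) has derivative `⟨Re tr ρ⟩₁(β) − N`.
* ★★★ `exists_forall_abs_freeEnergyDensity_sub_onePlaquette_le`: there is `K` with
  `|f(β) − #planes · F₁(β)| ≤ K |β|⁵` for all `|β| < betaOne d ρ / 4` — the free energy density per site of `ℤ^d` agrees with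
  `#planes = d(d−1)/2` copies of the ONE-PLAQUETTE free energy (which IS the two-dimensional free energy density per plaquette, exactly,
  for every `β` — LatticeQCDFlow's `freeEnergyDensity_two_eq`) through FOURTH order: the first inter-plaquette correction to the
  Balian–Drouffe–Itzykson series is `O(β⁵)` for every compact gauge group (part 4b's one-plaquette law for `f'` + the mean value inequality).

References: R. Balian, J.-M. Drouffe, C. Itzykson, PRD 11 (1975) 2104 §III–IV; K. Osterwalder, E. Seiler, Ann. Phys. 110 (1978) 440 §3.
-/

noncomputable section

open MeasureTheory ProbabilityTheory Set Filter Topology Finset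
open scoped NNReal
open Literature.MathematicalPhysics.QuantumLattice (LGConfig ZdEdge ZdPlaquette ymGibbsMeasures plaquetteObs plaquetteHolonomyZd
  freeEnergyDensity torusLogPartition HasFreeEnergyDensity continuous_plaquetteObs)
open Literature.MathematicalPhysics.QuantumFieldTheory hiding ZdEdge
open Literature.MathematicalPhysics.QuantumFieldTheory.PlaquetteLowerBound (reTr continuous_reTr)

namespace Summit.Ventures.YMGap.ZeroCouplingSlope

-- `G : Type` (universe `0`), as in gen 9's `PressureRegularity.hasDerivAt_freeEnergyDensity`.
variable {d N : ℕ} {G : Type} [Group G] [TopologicalSpace G] [IsTopologicalGroup G] [CompactSpace G]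
  [MeasurableSpace G] [BorelSpace G] [SecondCountableTopology G] [T2Space G] (ρ : G →* Matrix (Fin N) (Fin N) ℂ)

/-- Local shorthand: the coordinate planes `{(i, j) : i < j}` of `ℤ^d`. -/
local notation3 (prettyPrint := false) "𝔓" d => {q : Fin d × Fin d // q.1 < q.2}

omit [T2Space G] in
/-- **`f(0) = 0`**: at `β = 0` every torus partition function is `1` (product Haar is a probability measure). [folklore] -/
theorem freeEnergyDensity_zero_eq (hρ : Continuous ρ) : freeEnergyDensity d ρ 0 = 0 := by
  have hZ : ∀ L : ℕ, torusLogPartition d ρ 0 (L + 1) = 0 := fun L => by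
    unfold torusLogPartition
    rw [Literature.MathematicalPhysics.QuantumLattice.FreeEnergy.partitionFunction_eq_ofReal_integral ρ hρ]
    simp
  have h : HasFreeEnergyDensity d ρ 0 0 := by
    unfold HasFreeEnergyDensity
    simp only [hZ, mul_zero]
    exact tendsto_const_nhds
  exact h.freeEnergyDensity_eq

omit [SecondCountableTopology G] [T2Space G] in
/-- **The one-plaquette free energy and its derivative.** With `X = Re tr ρ − N` under Haar measure, `F₁ = cgf X Haar`, i.e.
`F₁(β) = log ∫ e^{−β(N − Re tr ρ)} dHaar`, and `F₁'(β) = ⟨Re tr ρ⟩₁(β) − N` (Mathlib `deriv_cgf`; the exponential moments of the bounded `X`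
exist everywhere). [folklore] -/
theorem hasDerivAt_cgf_onePlaquette (hρ : Continuous ρ) (β : ℝ) :
    HasDerivAt (cgf (fun g : G => reTr ρ g - N) (haarProbability G))
      ((∫ g, reTr ρ g * Real.exp (-β * ((N : ℝ) - reTr ρ g)) ∂haarProbability G) /
          (∫ g, Real.exp (-β * ((N : ℝ) - reTr ρ g)) ∂haarProbability G) - N) β := by
  obtain ⟨M, -, hM⟩ := exists_bound_trace_re_nonneg ρ hρ
  have hXc : Continuous fun g : G => reTr ρ g - N := (continuous_reTr ρ hρ).sub continuous_const
  have hint : ∀ t : ℝ, t ∈ interior (integrableExpSet (fun g : G => reTr ρ g - N) (haarProbability G)) := fun t => by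
    rw [Literature.MathematicalPhysics.QuantumLattice.integrableExpSet_eq_univ_of_abs_le hXc.aemeasurable (B := M + N)
      (ae_of_all _ fun g => ?_), interior_univ]
    · exact mem_univ _
    · have h1 := hM g
      simp only [reTr]; rw [abs_le] at h1 ⊢
      have hN : (0 : ℝ) ≤ N := Nat.cast_nonneg N
      constructor <;> linarith [h1.1, h1.2]
  have hmgf : ∀ t : ℝ, mgf (fun g : G => reTr ρ g - N) (haarProbability G) t =
      ∫ g, Real.exp (-t * ((N : ℝ) - reTr ρ g)) ∂haarProbability G := fun t => by
    simp only [mgf]; exact integral_congr_ae (ae_of_all _ fun g => by ring_nf)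
  have hpos : 0 < mgf (fun g : G => reTr ρ g - N) (haarProbability G) β :=
    mgf_pos (interior_subset (s := integrableExpSet _ _) (hint β))
  have hd : HasDerivAt (cgf (fun g : G => reTr ρ g - N) (haarProbability G))
      ((∫ g, (reTr ρ g - N) * Real.exp (β * (reTr ρ g - N)) ∂haarProbability G) /
        mgf (fun g : G => reTr ρ g - N) (haarProbability G) β) β := by
    have h := (hasDerivAt_mgf (hint β)).log hpos.ne'
    exact h
  have hz : ∫ g, Real.exp (-β * ((N : ℝ) - reTr ρ g)) ∂haarProbability G ≠ 0 := by rw [← hmgf]; exact hpos.ne'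
  convert hd using 1
  rw [hmgf]
  have hI1 : Integrable (fun g : G => reTr ρ g * Real.exp (-β * ((N : ℝ) - reTr ρ g))) (haarProbability G) :=
    ((continuous_reTr ρ hρ).mul ((continuous_const.mul (continuous_const.sub (continuous_reTr ρ hρ))).rexp)).integrable_of_hasCompactSupport
      (HasCompactSupport.of_compactSpace _)
  have hI2 : Integrable (fun g : G => Real.exp (-β * ((N : ℝ) - reTr ρ g))) (haarProbability G) :=
    ((continuous_const.mul (continuous_const.sub (continuous_reTr ρ hρ))).rexp).integrable_of_hasCompactSupport
      (HasCompactSupport.of_compactSpace _)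
  have e : ∫ g, (reTr ρ g - N) * Real.exp (β * (reTr ρ g - N)) ∂haarProbability G =
      (∫ g, reTr ρ g * Real.exp (-β * ((N : ℝ) - reTr ρ g)) ∂haarProbability G) -
        N * ∫ g, Real.exp (-β * ((N : ℝ) - reTr ρ g)) ∂haarProbability G := by
    rw [← integral_const_mul, ← integral_sub hI1 (hI2.const_mul _)]
    exact integral_congr_ae (ae_of_all _ fun g => by ring_nf)
  rw [e, sub_div, mul_div_assoc, div_self hz, mul_one]

/-- ★★★ **The free energy density of every lattice gauge theory is `#planes` copies of the one-plaquette free energy through FOURTH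
order.** For continuous `ρ` there is `K` such that for all `|β| < betaOne d ρ / 4`:
`|f(β) − #planes · log ∫ e^{−β(N − Re tr ρ)} dHaar| ≤ K |β|⁵` (`#planes = card {i < j} = d(d−1)/2`; the one-plaquette free energy IS the
two-dimensional free energy density per plaquette). Part 4b's one-plaquette law for `f'` integrated from `f(0) = 0` by the mean value
inequality. [folklore] -/
theorem exists_forall_abs_freeEnergyDensity_sub_onePlaquette_le (hρ : Continuous ρ) :
    ∃ K : ℝ, ∀ β : ℝ, |β| < betaOne d ρ / 4 →
      |freeEnergyDensity d ρ β - (Fintype.card (𝔓 d) : ℝ) * cgf (fun g : G => reTr ρ g - N) (haarProbability G) β| ≤ K * |β| ^ 5 := by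
  classical
  obtain ⟨K, hK⟩ := exists_forall_abs_deriv_freeEnergyDensity_add_onePlaquette_le (d' := d) ρ hρ
  -- differentiability of `f` on the corner (gen 13's analytic selection + gen 9's chord), re-derived as in part 4b
  obtain ⟨ν, hν, han⟩ := StrongCouplingAnalytic.exists_analytic_dlr_selection (d := d) ρ hρ
  obtain ⟨M, -, hM⟩ := exists_bound_trace_re_nonneg ρ hρ
  have hdiff : ∀ β : ℝ, |β| < betaOne d ρ / 4 → DifferentiableAt ℝ (freeEnergyDensity d ρ) β := fun β hβ => by
    have hβ' : β ∈ Ioo (-(betaOne d ρ / 4)) (betaOne d ρ / 4) := ⟨(abs_lt.1 hβ).1, (abs_lt.1 hβ).2⟩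
    refine (PressureRegularity.hasDerivAt_freeEnergyDensity ρ hρ (S := Ioo (-(betaOne d ρ / 4)) (betaOne d ρ / 4))
      (μ := ν) (fun b hb => (hν b (abs_lt.2 ⟨hb.1, hb.2⟩)).1)
      (fun b hb => Literature.MathematicalPhysics.QuantumLattice.isZdTranslationInvariant_of_mem_infiniteVolumeLimitPoints ρ
        (hν b (abs_lt.2 ⟨hb.1, hb.2⟩)).2.mem_infiniteVolumeLimitPoints)
      (isOpen_Ioo.mem_nhds hβ') fun q => ?_).differentiableAt
    have hbd : ∃ C, ∀ U : LGConfig d G, |plaquetteObs ρ 0 q.1.1 q.1.2 U| ≤ C :=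
      ⟨M, fun U => hM (plaquetteHolonomyZd U 0 q.1.1 q.1.2)⟩
    exact (han (plaquetteObs ρ 0 q.1.1 q.1.2) _
      (Literature.MathematicalPhysics.QuantumLattice.isCylinder_plaquetteObs_zero ρ q.1.1 q.1.2)
      (continuous_plaquetteObs ρ hρ 0 _ _) hbd β hβ').continuousAt
  refine ⟨max K 0, fun β hβ => ?_⟩
  have hβ0 : 0 < betaOne d ρ / 4 := div_pos (betaOne_pos (ρ := ρ) d) (by norm_num)
  -- `g = f − #planes · F₁` has `|g'| ≤ K s⁴ ≤ K β⁴` on the segment `[0, β]` and `g(0) = 0`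
  set g : ℝ → ℝ := fun s => freeEnergyDensity d ρ s - (Fintype.card (𝔓 d) : ℝ) * cgf (fun x : G => reTr ρ x - N) (haarProbability G) s
    with hg
  have hseg : ∀ s ∈ uIcc 0 β, |s| ≤ |β| := fun s hs => by
    rcases le_total 0 β with h | h
    · rw [uIcc_of_le h] at hs; rw [abs_of_nonneg hs.1, abs_of_nonneg h]; exact hs.2
    · rw [uIcc_of_ge h] at hs; rw [abs_of_nonpos hs.2, abs_of_nonpos h]; linarith [hs.1]
  have hg' : ∀ s ∈ uIcc 0 β, HasDerivWithinAt g (deriv (freeEnergyDensity d ρ) s - (Fintype.card (𝔓 d) : ℝ) *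
      ((∫ x, reTr ρ x * Real.exp (-s * ((N : ℝ) - reTr ρ x)) ∂haarProbability G) /
        (∫ x, Real.exp (-s * ((N : ℝ) - reTr ρ x)) ∂haarProbability G) - N)) (uIcc 0 β) s := fun s hs => by
    have hs' : |s| < betaOne d ρ / 4 := (hseg s hs).trans_lt hβ
    exact ((hdiff s hs').hasDerivAt.sub ((hasDerivAt_cgf_onePlaquette ρ hρ s).const_mul _)).hasDerivWithinAt
  have hbound : ∀ s ∈ uIcc 0 β, ‖deriv (freeEnergyDensity d ρ) s - (Fintype.card (𝔓 d) : ℝ) *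
      ((∫ x, reTr ρ x * Real.exp (-s * ((N : ℝ) - reTr ρ x)) ∂haarProbability G) /
        (∫ x, Real.exp (-s * ((N : ℝ) - reTr ρ x)) ∂haarProbability G) - N)‖ ≤ max K 0 * β ^ 4 := fun s hs => by
    have hs' : |s| < betaOne d ρ / 4 := (hseg s hs).trans_lt hβ
    have h := hK s hs'
    rw [Real.norm_eq_abs, show deriv (freeEnergyDensity d ρ) s - (Fintype.card (𝔓 d) : ℝ) *
      ((∫ x, reTr ρ x * Real.exp (-s * ((N : ℝ) - reTr ρ x)) ∂haarProbability G) /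
        (∫ x, Real.exp (-s * ((N : ℝ) - reTr ρ x)) ∂haarProbability G) - N) =
      deriv (freeEnergyDensity d ρ) s + (Fintype.card (𝔓 d) : ℝ) * ((N : ℝ) -
        (∫ x, reTr ρ x * Real.exp (-s * ((N : ℝ) - reTr ρ x)) ∂haarProbability G) /
          ∫ x, Real.exp (-s * ((N : ℝ) - reTr ρ x)) ∂haarProbability G) by ring]
    refine h.trans ?_
    have h4 : s ^ 4 ≤ β ^ 4 := by
      rw [show s ^ 4 = |s| ^ 4 from (Even.pow_abs (by decide) s).symm, show β ^ 4 = |β| ^ 4 from (Even.pow_abs (by decide) β).symm]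
      exact pow_le_pow_left₀ (abs_nonneg s) (hseg s hs) 4
    exact (mul_le_mul_of_nonneg_right (le_max_left K 0) (by positivity)).trans (mul_le_mul_of_nonneg_left h4 (le_max_right K 0))
  have hmvt := Convex.norm_image_sub_le_of_norm_hasDerivWithin_le hg' hbound (convex_uIcc 0 β) left_mem_uIcc right_mem_uIcc
  have hg0 : g 0 = 0 := by
    simp only [hg, freeEnergyDensity_zero_eq ρ hρ]
    haveI : IsProbabilityMeasure (haarProbability G) := inferInstance
    rw [cgf_zero]; ring
  rw [hg0, sub_zero, Real.norm_eq_abs, Real.norm_eq_abs, sub_zero] at hmvt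
  calc |freeEnergyDensity d ρ β - (Fintype.card (𝔓 d) : ℝ) * cgf (fun g : G => reTr ρ g - N) (haarProbability G) β|
      = |g β| := rfl
    _ ≤ max K 0 * β ^ 4 * |β| := hmvt
    _ = max K 0 * |β| ^ 5 := by rw [show β ^ 4 = |β| ^ 4 from (Even.pow_abs (by decide) β).symm]; ring

end Summit.Ventures.YMGap.ZeroCouplingSlope
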